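import Summits.SmoothPoincare4.SmoothPoincare4.Theorems.ConvexBisectionAcyclicBisectionExistsHurwitzReduction
import Summits.SmoothPoincare4.SmoothPoincare4.Theorems.ConvexBisectionAcyclicBisectionExistsBeltPageClause
import Summits.SmoothPoincare4.SmoothPoincare4.Theorems.ConvexBisectionAcyclicBisectionExistsStabBlockMoves
import Literature.Topology.FourManifolds.GluingProofs
import Literature.Geometry.Symplectic.SteinBoundaryContact
import HarnessLib

/-!
# N3 DESIGN (worker G5, lead c5, wave 6, 2026-08-17) — `stub_STgeo` = node N3 (ST-geo) of the NF4
# design: ONE FRONT STABILISATION PAIR as a rebuild over `Base (g+1)`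
# line `modp-braid-orbits`, crux `ConvexBisection.AcyclicBisectionExists` (stmt-SmoothPoincare4-10508)

`lean check`: rc 0; `sorry` exactly in the sub-node theorems `node_*`; the registered text of
`stub_STgeo` (`work/stubs/sig_stub_STgeo.txt`) is the theorem `node_STgeo_proved` at the end, PROVED
from the sub-nodes.  Companion report: `work/stubs/G5-REPORT.md`.

## 0. VERDICT: TRUE; the right decomposition is NOT "carve `K` out of the old cap"

W6 (`work/design/NF4_Design.lean`, N3 row) proposed `Base g = K ∪ Base (g+1)'`,
`K = (∂Base g × I) ∪ 2 h¹ ∪ 4 h²`, `X' := X ∪_Ψ K`.  Thinking it through: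
* Topologically `M ∖ X' ≅ Base (g+1)` IS consistent (read from the top, `Base g ≅ Base (g+1) ∪ 4 h² ∪
  2 h³`: `♮^{2g+2} S¹×B³` does sit inside `♮^{2g} S¹×B³` as the complement of two (2,3)- and two
  (1,2)-type dual pairs), so the lead's worry "the genus goes UP inside the old cap" is not an
  obstruction by itself.  BUT:
* (a) `X ⊂ X'` LITERALLY is impossible for fibred data: the new base embedding `jA' : Base (g+1) ∖
  cores → X'` would have to continue `D.jA` across the whole old seam `D.jA (∂Base g ∖ cores)` into
  `K`, i.e. through the SEAM MAP `e := Ψ ∘ bX.incl⁻¹ ∘ D.jA : ∂Base g ∖ cores → ∂Base g` (page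
  preserving, image = complement of the `n` deep belt circles `Ψ(β_k)`); `e` realises the surgery
  near the cores and does not extend continuously over them, and away from them it carries an
  arbitrary GAUGE (a family of page self-diffeomorphisms `φ_θ`, `θ` in the free arc, in an arbitrary
  mapping class `φ ∈ Mod^±(F_{g,1})`: post-composing `Ψ` with `∂ρ` for any fibred automorphism `ρ`
  of the cap changes `φ` and not `M`).  So the new data must be obtained by TRANSPORT along
  diffeomorphisms, never by extending `D`; and every construction must be gauge-covariant.
* (b) `N := K ∪_{Ψ'} Base (g+1) ≅ Base g rel ∂` (the honest content of "`M ∖ X' ≅ Base (g+1)`")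
  unpacks into: 1-handle presentation of `Base (g+1)` + two (1,2)-cancellations + trading of the two
  negative block handles across the new seam (the Kosinski duality of T3) + a page-preserving
  identification across four Lefschetz surgeries whose total monodromy `t_a t_b t_b⁻¹ t_a⁻¹` is
  trivial — the last is exactly N1's open-book surgery-crossing model ("N1-cross"), FOUR times.
* (c) The surgery-crossing model is avoided on the N3 side altogether by the ETNYRE–FULLER TWO-SIDED
  ARGUMENT (IMRN 2006, §2 p. 5; Baykur 2006 Lemma 1) done where it is natural: two cancelling pairs on
  the handlebody side, two on the cap side AT THE SAME TWO PAGE ANGLES (so that the stabilised seams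
  coincide pointwise — no page-preserving map across surgeries is ever constructed), then the cap's two
  positive Lefschetz handles traded to the handlebody side, where their duals are their partners'
  own belt tori pushed into the ADJACENT page.  This yields the NATURAL word
    `natWord g c l = (a,+)(a,−)(b,+)(b,−) ++ embed l`,  `a = newE g + embed g c`, `b = newF g`,
  and the registered `stabBlock g c ++ embed l = (a,+)(b,+)(b,−)(a,−) ++ embed l` is TWO SIGNED
  HURWITZ MOVES away (LANDED: `helper_hurwitzSteps_natBlock_stabBlock`, p165085), i.e. follows by the
  landed (HS) reduction (`hurwitzStep_of_redecomposition ∘ redecomposition_of_geometric_of_belt`,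
  p134969, with the LANDED belt clause `helper_belt_pageClause` = N2) from N1 = `node_M2geo`, which
  NF4 needs anyway.  NET EFFECT: the surgery-crossing technology is needed ONCE (in N1), not twice.
* (d) The data-level "∀ gluings `M ≅ M'`" clause of the registered text follows from the MODEL-level
  natural stabilisation by gluing the old data once (`exists_isBoundaryGluing_holds`) and uniqueness of
  gluings (`nonempty_diffeomorph_of_isBoundaryGluing_holds`) — see `node_STgeo_proved`.
* (e) N3b (G7) as a free-standing page map is NOT consumable (G7 reached the same conclusion): the old
  circles must be re-planted by the boundary trace of the 4-dimensional 1-handle identification `E`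
  of N3d-1; homological re-planting (N3a on `embed v`) loses the manifold (equal classes ≠ isotopic
  curves).  N3b becomes clause `flat/shadow_embed` of `StabBaseData` (N3d-1); G7's landed
  `shadow_comp_eq_embed` (…ShadowEmbedFunctorial) is its homological half.

## 1. ASSEMBLY (all PROVED here): registered `stub_STgeo` ⟸ `node_STnat` ∧ `node_M2geo` (N1)
   `node_STgeo_proved := glue ∘ (hs ∘ hs ∘ node_STnat) ∘ uniqueness`, `hs := (HS)` from N1 + landed N2.

## 2. NODE TABLE for `node_STnat` (N3-nat, model level; sizes = honest estimates in lines of Lean)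

* N3d-0 `node_normalisedDatum`  GAUGE + RESPACING of the given fibred datum            M–L  700–1100
    (old handles moved to directions `pageDir (n+4) (k+4)` by G4's sector rotations
    `helper_rotFlow_sector` + transfers; old circles squeezed off the page rims; seam map `e = id`
    on the thickened binding tube `‖x‖² > 4 − ε₁` where the feet of the 1-handles of N3d-1 sit: there
    `e = (P, v) ↦ (P', μ v)`, fibred-isotopic to the identity, + collar extension
    `BoundaryData.exists_diffeomorph_comp_incl_eq_of_isDiffeotopicToId` + transfer; if `e` reverses
    the page orientation, first replace `Ψ` by `∂σ ∘ Ψ`, `σ = baseReflection` (V3, `w ∘ σ = w`)).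
* N3d-1 `node_stabBaseData`     THE STABILISED BASE: `Nonempty (StabBaseData g n c)`    XXL 2500–4500
    = G1 fibred 1-handle presentation `E : Base g ∪ 2h¹ = Base (g+1)` (`w ∘ E.jA = w`, flat pages to
    flat pages, `shadow ∘ E.jA = embed ∘ shadow` [this is N3b], page twisting transported) + the block
    curves `A` (class `a`, crossing the belt sphere of 1-handle 0 once, in the page of direction
    `pageDir (n+4) 0`; built as band-core ∪ rim arc # `E ∘ γ_c`, `γ_c` from N3a in genus `g`) and `B`
    (class `b`, page `pageDir (n+4) 2`) + their Lefschetz attaching maps `qA qB` (twisting `−1`, N3c via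
    TUBE `exists_handleAttachingMap_of_isKnotFraming_holds`).  Splits: G1a smooth page-embedding family
    (1000–1800), G1b the 4-dim `E` (700–1200), G1c shadows (300–600; G7's functoriality brick), G1d
    twisting transport (300–500), G1e block curves + maps (500–900).
* N3d-2 `node_cancel`           (1,2)-HANDLE CANCELLATION in Kosinski's language        XL  1200–2000
    (general lemma: `M ∪ h¹ ∪ h²` with attaching circle meeting the belt sphere transversally once is
    `M` by a diffeomorphism which is the identity off a thin collar neighbourhood of feet ∪ attaching
    region; applied twice: `Λ : V := Base (g+1) ∪ qA ∪ qB ≅ Base g`, identity off `modelRegion`).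
* N3d-3 `node_rebase`           THE TWO-SIDED MODEL `M = X₁ ∪_ι W₂` over `Base (g+1)`     L–XL 900–1600
    (`X₁ := V ∪ old⁗ ≅ X` by `Λ` + multi-attachment associativity + uniqueness; `W₂ := V^e :=` the
    cap-side copy with 1-handles at the SAME feet (`e = id` there) and 2-handles along the
    `ê`-transported maps, `ê = e × id` on a fibred collar; `Λ^e := ê ∘ Λ ∘ ê_V⁻¹ ∪ E⁻¹ : V^e ≅ Base g`;
    `ι := ∂(Λ^e)⁻¹ ∘ Ψ ∘ ∂G_X` is then the IDENTITY in model coordinates on the two block handles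
    (matching clause) and direction-preserving on seams; two `IsBoundaryGluing.transfer`s keep `M`).
* N3d-4/5/6 `node_trade`        TRADE + DUAL + FINISH ⇒ `ModelsOnFibred M (g+1) natWord`  XL–XXL 1900–3500
    N3d-4 TRADE (400–800): T3's landed general trading (Y6 `exists_complementPiece`, X1
    `exists_dualAttachmentData`, V5 standard form) applied with the roles swapped — FROM the cap-side
    `W₂` (both its handles) INTO `X₁`: `M = Base (g+1) ∪_φ (X₁ ∪ duals)`; by the matching clause the
    dual maps are collar-pushes of `X₁`'s OWN belt tubes of `qA`, `qB`.
    N3d-5 DUAL-std (1000–1800): the collar-push of the belt tube of the STANDARD handle `qA`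
    (explicit TUBE model of N3d-1) along `X₁`'s fibred collar is fibred-isotopic to the standard
    Lefschetz map along `A` pushed into the page `pageDir (n+4) 0 ⁻` with twisting `+1` (the T3c/ST4
    computation of X3/Y3, here for an explicit standard handle: no `Hgap`).
    N3d-6 FINISH (500–900): ISO `isMultiAttachment_of_linkIsotopyInBoundary_holds`, G4's sector
    rotation to positions `1` and `3`, `MultiAttachmentData.isMultiAttachment_cons` ×2, reindexing
    `Fin (n+4)`, `IsLefschetzLink (g+1) (natWord g c l)`, page clause.
  TOTAL N3d ≈ 7–12.6 kLoC (W6's 2.5–3.5 k was the cancellation part only).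
* inputs (neighbours): N3a `node_STcurve` (G6; used inside N3d-1 in genus `g` for `γ_c`), N3c (TUBE +
  prescribed page twisting; inside N3d-1), N1 `node_M2geo` (G4), N2 LANDED, T3 trading files LANDED.

## 3. Why no Laudenbach–Poénaru / no extension of gauge-carrying boundary maps is needed
The only place the gauge `φ` could bite is the cap-side cancelling pair of `a`, whose deep arc has
class `c`; it is neutralised by building the cap-side pair as the `ê`-TRANSPORT of the handlebody-side
pair (`ê = e × id` on a fibred collar over the block sector ∪ binding region, where `e` is defined)
and conjugating the ONE cancellation diffeomorphism `Λ` (N3d-3): the cap-side block curves are then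
`e`-twisted — irrelevant, they are traded away — while the traded duals land on the handlebody's own
standard belt tori.  `e = id` is only needed near the four binding points (feet), which are balls.
-/

noncomputable section

set_option linter.dupNamespace false

open scoped Manifold ContDiff Topology Real
open Set Function

namespace Summit.SmoothPoincare4.SmoothPoincare4.Theorems.AcyclicBisectionExists.ModpBraidOrbits

namespace N3Design

open Literature.GroupTheory.CombinatorialGroupTheory.SignedHurwitz
open Literature.Topology.FourManifolds Literature.Topology.FourManifolds.LefschetzBase
open Literature.Topology.FourManifolds.HandleAttachingMap
open Literature.Geometry.Symplectic
open ModelsOnFibredOfReach StabBlockMoves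

/-! ## §0 The natural stabilised word -/

/-- **The NATURAL stabilised word** `(a,+)(a,−)(b,+)(b,−) ++ embed l`, `a = newE g + embed g c`,
`b = newF g`: what the two-sided Etnyre–Fuller stabilisation followed by trading produces (each
traded dual lands in the page adjacent to its partner).  Two signed Hurwitz moves from
`stabBlock g c ++ embed l` (`helper_hurwitzSteps_natBlock_stabBlock`, landed p165085). [folklore] -/
def natWord (g : ℕ) (c : Fin g ⊕ Fin g → ℤ) (l : IntWord g) : IntWord (g + 1) :=
  (newE g + embed g c, true) :: (newE g + embed g c, false) :: (newF g, true) :: (newF g, false) ::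
    mapWord (embed g) l

/-- The natural word has `n + 4` letters. [folklore] -/
theorem length_natWord (g : ℕ) (c : Fin g ⊕ Fin g → ℤ) (l : IntWord g) :
    (natWord g c l).length = l.length + 4 := by
  simp [natWord, length_mapWord]

/-! ## §1 N1 (input node) and the PROVED reductions: registered text ⟸ model-level (ST-front) ⟸ N3-nat + (HS) -/

/-- **N1 (`node_M2geo`) — one signed Hurwitz move as an open-book-exact re-decomposition, transfer
form** (VERBATIM the node of `work/design/NF4_Design.lean`, registered as `stub_M2geo`; worker G4 of
wave 6).  Needed here only through (HS). [cite: GompfStipsicz1999, §8.2] -/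
theorem node_M2geo :
    ∀ (g : ℕ) (l l' : IntWord g), HurwitzStep (stdSymp ℤ g) l l' →
      ∀ (X : Type) [TopologicalSpace X] [T2Space X] [SecondCountableTopology X] [CompactSpace X]
        [ChartedSpace (EuclideanHalfSpace 4) X] [IsManifold (𝓡∂ 4) ∞ X]
        (h : Fin l.length → HandleAttachingMap 3 2 (Base g))
        (D : MultiAttachmentData h (𝓡∂ 4) X) (bX : BoundaryData (𝓡∂ 4) X (𝓡 3))
        (Ψ : bX.carrier ≃ₘ⟮𝓡 3, 𝓡 3⟯ (bBase g).carrier),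
        IsLefschetzLink g l h →
        (∀ (y : bX.carrier) (a : ↥(coresComplement h)), bX.incl y = D.jA a →
          ∃ c : ℝ, 0 < c ∧ w g ((bBase g).incl (Ψ y)).1 = (c : ℂ) * w g (a : Base g).1) →
        ∃ (X' : Type) (_ : TopologicalSpace X') (_ : T2Space X') (_ : SecondCountableTopology X')
          (_ : CompactSpace X') (_ : ChartedSpace (EuclideanHalfSpace 4) X')
          (_ : IsManifold (𝓡∂ 4) ∞ X') (h' : Fin l'.length → HandleAttachingMap 3 2 (Base g))
          (D' : MultiAttachmentData h' (𝓡∂ 4) X') (G : X ≃ₘ⟮𝓡∂ 4, 𝓡∂ 4⟯ X'),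
          IsLefschetzLink g l' h' ∧
          ∀ a' : ↥(coresComplement h'), G.symm (D'.jA a') ∈ (𝓡∂ 4).boundary X →
            (∃ a : ↥(coresComplement h), G.symm (D'.jA a') = D.jA a ∧
              ∃ c : ℝ, 0 < c ∧ w g (a' : Base g).1 = (c : ℂ) * w g (a : Base g).1) ∨
            (∃ (k : Fin l.length) (b : ↥(beltPiece 3 2)), G.symm (D'.jA a') = D.jB k b ∧
              G.symm (D'.jA a') ∉ range D.jA ∧
              ∃ c : ℝ, 0 < c ∧ w g (a' : Base g).1 = (c : ℂ) * pageDir l.length k) := by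
  sorry

/-- **(HS) at every genus from N1 and the LANDED belt clause N2** (`helper_belt_pageClause`, V4)
through W6's landed `redecomposition_of_geometric_of_belt` and `hurwitzStep_of_redecomposition`
(p134969). [cite: GompfStipsicz1999, §8.2] -/
theorem hs_of_nodes
    (hM2 : ∀ (g : ℕ) (l l' : IntWord g), HurwitzStep (stdSymp ℤ g) l l' →
      ∀ (X : Type) [TopologicalSpace X] [T2Space X] [SecondCountableTopology X] [CompactSpace X]
        [ChartedSpace (EuclideanHalfSpace 4) X] [IsManifold (𝓡∂ 4) ∞ X]
        (h : Fin l.length → HandleAttachingMap 3 2 (Base g))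
        (D : MultiAttachmentData h (𝓡∂ 4) X) (bX : BoundaryData (𝓡∂ 4) X (𝓡 3))
        (Ψ : bX.carrier ≃ₘ⟮𝓡 3, 𝓡 3⟯ (bBase g).carrier),
        IsLefschetzLink g l h →
        (∀ (y : bX.carrier) (a : ↥(coresComplement h)), bX.incl y = D.jA a →
          ∃ c : ℝ, 0 < c ∧ w g ((bBase g).incl (Ψ y)).1 = (c : ℂ) * w g (a : Base g).1) →
        ∃ (X' : Type) (_ : TopologicalSpace X') (_ : T2Space X') (_ : SecondCountableTopology X')
          (_ : CompactSpace X') (_ : ChartedSpace (EuclideanHalfSpace 4) X')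
          (_ : IsManifold (𝓡∂ 4) ∞ X') (h' : Fin l'.length → HandleAttachingMap 3 2 (Base g))
          (D' : MultiAttachmentData h' (𝓡∂ 4) X') (G : X ≃ₘ⟮𝓡∂ 4, 𝓡∂ 4⟯ X'),
          IsLefschetzLink g l' h' ∧
          ∀ a' : ↥(coresComplement h'), G.symm (D'.jA a') ∈ (𝓡∂ 4).boundary X →
            (∃ a : ↥(coresComplement h), G.symm (D'.jA a') = D.jA a ∧
              ∃ c : ℝ, 0 < c ∧ w g (a' : Base g).1 = (c : ℂ) * w g (a : Base g).1) ∨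
            (∃ (k : Fin l.length) (b : ↥(beltPiece 3 2)), G.symm (D'.jA a') = D.jB k b ∧
              G.symm (D'.jA a') ∉ range D.jA ∧
              ∃ c : ℝ, 0 < c ∧ w g (a' : Base g).1 = (c : ℂ) * pageDir l.length k)) :
    ∀ (M : Type) [TopologicalSpace M] [T2Space M] [SecondCountableTopology M]
      [ChartedSpace (EuclideanSpace ℝ (Fin 4)) M] [IsManifold (𝓡 4) ∞ M] (g : ℕ) (l l' : IntWord g),
      ModelsOnFibred M g l → HurwitzStep (stdSymp ℤ g) l l' → ModelsOnFibred M g l' :=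
  hurwitzStep_of_redecomposition (redecomposition_of_geometric_of_belt hM2 helper_belt_pageClause)

/-- **(ST-front) at MODEL level from N3-nat and (HS)**: the natural stabilised model, then the two
signed Hurwitz moves of `hurwitzSteps_natBlock_stabBlock_front` (landed p165085).
[cite: Baykur2006, Lemma 1] -/
theorem st_front_of_nodes
    (hnat : ∀ (M : Type) [TopologicalSpace M] [T2Space M] [SecondCountableTopology M]
      [ChartedSpace (EuclideanSpace ℝ (Fin 4)) M] [IsManifold (𝓡 4) ∞ M] (g : ℕ) (l : IntWord g)
      (c : Fin g ⊕ Fin g → ℤ), (c = 0 ∨ IsPrimitive c) →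
      ModelsOnFibred M g l → ModelsOnFibred M (g + 1) (natWord g c l))
    (hs : ∀ (M : Type) [TopologicalSpace M] [T2Space M] [SecondCountableTopology M]
      [ChartedSpace (EuclideanSpace ℝ (Fin 4)) M] [IsManifold (𝓡 4) ∞ M] (g : ℕ) (l l' : IntWord g),
      ModelsOnFibred M g l → HurwitzStep (stdSymp ℤ g) l l' → ModelsOnFibred M g l') :
    ∀ (M : Type) [TopologicalSpace M] [T2Space M] [SecondCountableTopology M]
      [ChartedSpace (EuclideanSpace ℝ (Fin 4)) M] [IsManifold (𝓡 4) ∞ M] (g : ℕ) (l : IntWord g)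
      (c : Fin g ⊕ Fin g → ℤ), (c = 0 ∨ IsPrimitive c) →
      ModelsOnFibred M g l → ModelsOnFibred M (g + 1) (stabBlock g c ++ mapWord (embed g) l) := by
  intro M _ _ _ _ _ g l c hc hM
  obtain ⟨l₁, h₁, h₂⟩ := hurwitzSteps_natBlock_stabBlock_front c l
  have h0 : ModelsOnFibred M (g + 1) (natWord g c l) := hnat M g l c hc hM
  exact hs M (g + 1) _ _ (hs M (g + 1) _ _ h0 h₁) h₂

/-- **The registered text of `stub_STgeo` from a MODEL-level front stabilisation** (how the data-level
"all gluings are diffeomorphic" clause is recovered): glue the old data once, `P₀ := X ∪_Ψ Base g`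
(`exists_isBoundaryGluing_holds`), which is a fibred model (`modelsOnFibred_of_data`); stabilise it at
model level; unpack the new fibred data of `P₀`; any gluing `M` of the old data and any gluing `M'` of
the new data are both diffeomorphic to `P₀` (`nonempty_diffeomorph_of_isBoundaryGluing_holds`).
[cite: EtnyreFuller2006, §2] -/
theorem stgeo_of_st_front
    (hst : ∀ (M : Type) [TopologicalSpace M] [T2Space M] [SecondCountableTopology M]
      [ChartedSpace (EuclideanSpace ℝ (Fin 4)) M] [IsManifold (𝓡 4) ∞ M] (g : ℕ) (l : IntWord g)
      (c : Fin g ⊕ Fin g → ℤ), (c = 0 ∨ IsPrimitive c) →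
      ModelsOnFibred M g l → ModelsOnFibred M (g + 1) (stabBlock g c ++ mapWord (embed g) l)) :
    ∀ (g : ℕ) (l : IntWord g) (c : Fin g ⊕ Fin g → ℤ), (c = 0 ∨ IsPrimitive c) →
      ∀ (X : Type) [TopologicalSpace X] [T2Space X] [SecondCountableTopology X] [CompactSpace X]
        [ChartedSpace (EuclideanHalfSpace 4) X] [IsManifold (𝓡∂ 4) ∞ X]
        (h : Fin l.length → HandleAttachingMap 3 2 (Base g))
        (D : MultiAttachmentData h (𝓡∂ 4) X) (bX : BoundaryData (𝓡∂ 4) X (𝓡 3))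
        (Ψ : bX.carrier ≃ₘ⟮𝓡 3, 𝓡 3⟯ (bBase g).carrier),
        IsLefschetzLink g l h →
        (∀ (y : bX.carrier) (a : ↥(coresComplement h)), bX.incl y = D.jA a →
          ∃ c : ℝ, 0 < c ∧ w g ((bBase g).incl (Ψ y)).1 = (c : ℂ) * w g (a : Base g).1) →
        ∃ (X' : Type) (_ : TopologicalSpace X') (_ : T2Space X') (_ : SecondCountableTopology X')
          (_ : CompactSpace X') (_ : ChartedSpace (EuclideanHalfSpace 4) X')
          (_ : IsManifold (𝓡∂ 4) ∞ X')
          (h' : Fin (stabBlock g c ++ mapWord (embed g) l).length →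
            HandleAttachingMap 3 2 (Base (g + 1)))
          (D' : MultiAttachmentData h' (𝓡∂ 4) X') (bX' : BoundaryData (𝓡∂ 4) X' (𝓡 3))
          (Ψ' : bX'.carrier ≃ₘ⟮𝓡 3, 𝓡 3⟯ (bBase (g + 1)).carrier),
          IsLefschetzLink (g + 1) (stabBlock g c ++ mapWord (embed g) l) h' ∧
          (∀ (y : bX'.carrier) (a : ↥(coresComplement h')), bX'.incl y = D'.jA a →
            ∃ c' : ℝ, 0 < c' ∧
              w (g + 1) ((bBase (g + 1)).incl (Ψ' y)).1 = (c' : ℂ) * w (g + 1) (a : Base (g + 1)).1) ∧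
          ∀ (M M' : Type) [TopologicalSpace M] [ChartedSpace (EuclideanSpace ℝ (Fin 4)) M]
            [IsManifold (𝓡 4) ∞ M] [TopologicalSpace M'] [ChartedSpace (EuclideanSpace ℝ (Fin 4)) M']
            [IsManifold (𝓡 4) ∞ M'],
            IsBoundaryGluing bX (bBase g) Ψ (𝓡 4) M → IsBoundaryGluing bX' (bBase (g + 1)) Ψ' (𝓡 4) M' →
            Nonempty (M ≃ₘ⟮𝓡 4, 𝓡 4⟯ M') := by
  intro g l c hc X _ _ _ _ _ _ h D bX Ψ hlink hpage
  -- glue the old data once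
  obtain ⟨P₀, _, _, _, _, _, _, hglue₀⟩ := exists_isBoundaryGluing_holds bX (bBase g) Ψ
  have hP₀ : ModelsOnFibred P₀ g l := modelsOnFibred_of_data hlink D bX Ψ hglue₀ hpage
  -- stabilise the glued manifold at model level and unpack
  obtain ⟨X', _, _, _, _, _, _, h', D', bX', Ψ', hlink', hglue', hpage'⟩ := hst P₀ g l c hc hP₀
  refine ⟨X', inferInstance, inferInstance, inferInstance, inferInstance, inferInstance,
    inferInstance, h', D', bX', Ψ', hlink', hpage', ?_⟩
  intro M M' _ _ _ _ _ _ hM hM'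
  obtain ⟨e₁⟩ := nonempty_diffeomorph_of_isBoundaryGluing_holds hM hglue₀
  obtain ⟨e₂⟩ := nonempty_diffeomorph_of_isBoundaryGluing_holds hglue' hM'
  exact ⟨e₁.trans e₂⟩


/-! ## §2 INTERFACES of the pieces of N3-nat (design-local definitions)

To register a piece as a stub these definitions must be inlined or landed first (as a documented
`def`/`structure` file, kind = definition); they are kept here as NAMED predicates so that the pieces
compose literally (`node_STnat_of_pieces`). -/

/-- **The block sector of directions** for a word of length `n` stabilised to length `n + 4`: the open
sector of `ℂ ∖ 0` of arguments `2πt/(n+4)`, `t ∈ (−17/4, 1/4)`, which contains the four block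
directions `pageDir (n+4) i = e^{−2πi(i+½)/(n+4)}`, `i < 4` (`t = −i − ½`) and stays at angular
distance `π/(2(n+4))` from the first and last old directions `pageDir (n+4) 4`, `pageDir (n+4) (n+3)`
(`t = −9/2`, `t ≡ 1/2`). [folklore] -/
def blockSector (n : ℕ) : Set ℂ :=
  {z | ∃ r t : ℝ, 0 < r ∧ t ∈ Ioo (-(17 / 4 : ℝ)) (1 / 4) ∧
    z = (r : ℂ) * Complex.exp ((2 * π * t / ((n + 4 : ℕ) : ℝ) : ℝ) * Complex.I)}

/-- **The model region** of the old cap / old base `Base g` inside which everything new happens: the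
collar of depth `δ₀` (in the defining function `rho`) over the thickened binding tube `‖x‖² > 4 − ε₁`
(the closed binding tube `‖x‖ ≥ 2` of `∂Base g` is where the feet `J × D²` of the two 1-handles sit —
they are LONG in the `w`-direction, meeting every page, as the bands of the new page must; all flat
pages have `‖x‖² < 4`, and the old attaching circles are first pushed into `‖x‖² < 4 − ε₁`, N3d-0) and
over the block sector of directions (where the block 2-handles attach).  The cancellation
diffeomorphism of N3d-2 is the identity off it. [folklore] -/
def modelRegion (g n : ℕ) (δ₀ ε₁ : ℝ) : Set (Base g) :=
  {p | 1 / 4 - δ₀ < rho g p.1 ∧ (4 - ε₁ < ‖cx p.1‖ ^ 2 ∨ w g p.1 ∈ blockSector n)}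

/-- The model arc `s ↦ (sin s, cos s · u)` of the boundary sphere `∂D⁴` crossing the belt sphere
`{x_λ = 0, ‖x‖ = 1}` of the model 1-handle `D¹ × D³` (`x_λ` = coordinate `0`) transversally at
`s = 0` in the unit direction `u ∈ S² ⊂ ℝ³`. [folklore] -/
def crossVec (u : EuclideanSpace ℝ (Fin 3)) (s : ℝ) : EuclideanSpace ℝ (Fin 4) :=
  WithLp.toLp 2 ![Real.sin s, Real.cos s * u 0, Real.cos s * u 1, Real.cos s * u 2]

/-- **N3d-1 interface: THE STABILISED BASE DATA for `(g, n, c)`** — a FIBRED 1-HANDLE PRESENTATION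
`E` of `Base (g+1)` over `Base g` (two index-1 Kosinski attaching maps `q1 i : T¹ → Base g` with ranges in
the binding part of the model region, and multi-attachment data `E` on the manifold `Base (g+1)` itself)
which preserves `w` on the nose, sends flat pages into flat pages, acts as `embed g` on shadows of page
loops (= node N3b of the NF4 design, now a clause) and transports page twistings of framed embedded
page curves; together with the TWO BLOCK CURVES `A` (class `a = newE g + embed g c`, flat page of
direction `pageDir (n+4) 0`, crossing the belt sphere of the 1-handle `0` exactly once, in model
position, and missing that of the 1-handle `1`) and `B` (class `b = newF g`, page `pageDir (n+4) 2`,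
crossing the belt sphere of `1` once, missing that of `0`), and their LEFSCHETZ ATTACHING MAPS
`qA`, `qB` (attaching circle `A` resp. `B`, page twisting `−1`, disjoint ranges inside the block part
of the model region of `Base (g+1)`).  Milnor 1968 §9 (the fibre of `x^{2g+1}` inside that of
`x^{2g+3}`); Etnyre–Fuller 2006 §2 (stabilisation = 1-handle on the page + vanishing cycle through it
once); Baykur 2006 Lemma 1 (`a = e + c`, `b = f`). [cite: EtnyreFuller2006, §2] -/
structure StabBaseData (g n : ℕ) (c : Fin g ⊕ Fin g → ℤ) where
  /-- the two 1-handle attaching maps on the old base -/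
  q1 : Fin 2 → HandleAttachingMap 3 1 (Base g)
  /-- `Base (g+1)` IS `Base g` with these two 1-handles attached -/
  E : MultiAttachmentData q1 (𝓡∂ 4) (Base (g + 1))
  /-- the block curve of class `a = newE g + embed g c` -/
  A : Metric.sphere (0 : EuclideanSpace ℝ (Fin 2)) 1 → Base (g + 1)
  /-- the block curve of class `b = newF g` -/
  B : Metric.sphere (0 : EuclideanSpace ℝ (Fin 2)) 1 → Base (g + 1)
  /-- the Lefschetz attaching map along `A` -/
  qA : HandleAttachingMap 3 2 (Base (g + 1))
  /-- the Lefschetz attaching map along `B` -/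
  qB : HandleAttachingMap 3 2 (Base (g + 1))
  /-- the depth of the model collar -/
  δ₀ : ℝ
  hδ₀ : 0 < δ₀
  /-- the thickness of the binding part of the model region -/
  ε₁ : ℝ
  hε₁ : 0 < ε₁ ∧ ε₁ ≤ 1 / 2
  /-- the 1-handle attaching maps (Kosinski tubes around the feet `J_i × D²`, attaching 0-spheres on
  the binding) have ranges in the binding part of the model region; `E` is NOT fibred there -/
  range_q1 : ∀ (i : Fin 2) (y : ↥(handleTube 3 1)),
    (q1 i).toFun y ∈ modelRegion g n δ₀ ε₁ ∧ 4 - ε₁ < ‖cx ((q1 i).toFun y).1‖ ^ 2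
  /-- flat pages miss the two attaching 0-spheres -/
  page_mem : ∀ (d : ℂ), ‖d‖ = 1 → ∀ p ∈ page g d, p ∈ coresComplement q1
  /-- `E` is FIBRED off the 1-handle ranges: `w ∘ E.jA = w` there (it cannot be fibred near the feet:
  a new page is the image of the old page off the feet plus two bands) -/
  fibred : ∀ a : ↥(coresComplement q1), (∀ i y, (q1 i).toFun y ≠ (a : Base g)) →
    w (g + 1) (E.jA a).1 = w g (a : Base g).1
  /-- flat page points off the 1-handle ranges go INTO the flat page of the same direction -/
  flat : ∀ (d : ℂ), ‖d‖ = 1 → ∀ (a : ↥(coresComplement q1)), (∀ i y, (q1 i).toFun y ≠ (a : Base g)) →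
    (a : Base g) ∈ page g d → E.jA a ∈ page (g + 1) d
  /-- only points of the old model region are taken into the new model region (depth and binding
  compatibility of `E`; with `fibred` this keeps the old handles, kept off the old model region by
  N3d-0, off the new one, and puts the support of the cancellation of N3d-2 over the old model region) -/
  model_pullback : ∀ a : ↥(coresComplement q1), E.jA a ∈ modelRegion (g + 1) n δ₀ ε₁ →
    (a : Base g) ∈ modelRegion g n δ₀ ε₁
  /-- N3b: `E` acts as `embed g` on shadows of page loops -/
  shadow_embed : ∀ (d : ℂ) (hd : ‖d‖ = 1)
    (K : Metric.sphere (0 : EuclideanSpace ℝ (Fin 2)) 1 → Base g) (hK : Continuous K)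
      (hKd : ∀ θ, K θ ∈ page g d),
      ∃ hK' : Continuous fun θ => E.jA ⟨K θ, page_mem d hd (K θ) (hKd θ)⟩,
        shadow (g + 1) (fun θ => E.jA ⟨K θ, page_mem d hd (K θ) (hKd θ)⟩) hK' =
          embed g (shadow g K hK)
  /-- page twistings of framed embedded page curves off the 1-handle ranges are transported -/
  twisting_transport : ∀ (d : ℂ) (hd : ‖d‖ = 1)
    (K : Metric.sphere (0 : EuclideanSpace ℝ (Fin 2)) 1 → Base g) (ν : Metric.sphere (0 : EuclideanSpace ℝ (Fin 2)) 1 → EuclideanSpace ℝ (Fin 4)),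
      Manifold.IsSmoothEmbedding (𝓡 1) (𝓡∂ 4) ∞ K → (hKd : ∀ θ, K θ ∈ page g d) →
      (∀ θ i y, (q1 i).toFun y ≠ K θ) → IsKnotFraming K ν →
      pageTwisting (g + 1) (fun θ => E.jA ⟨K θ, page_mem d hd (K θ) (hKd θ)⟩)
          (fun θ => mfderiv (𝓡∂ 4) (𝓡∂ 4) E.jA ⟨K θ, page_mem d hd (K θ) (hKd θ)⟩ (ν θ)) =
        pageTwisting g K ν
  /-- `A` is a smoothly embedded curve in the flat page of direction `pageDir (n+4) 0` … -/
  A_emb : Manifold.IsSmoothEmbedding (𝓡 1) (𝓡∂ 4) ∞ A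
  A_page : ∀ θ, A θ ∈ page (g + 1) (pageDir (n + 4) 0)
  /-- … of class `a` … -/
  A_shadow : shadow (g + 1) A A_emb.isEmbedding.continuous = newE g + embed g c
  /-- … crossing the belt sphere of 1-handle `0` exactly once, in model position, and missing that of `1` -/
  A_cross : ∃ (t₀ : ℝ) (u : EuclideanSpace ℝ (Fin 3)) (ε : ℝ), ‖u‖ = 1 ∧ 0 < ε ∧
    (∀ s ∈ Ioo (-ε) ε, ∃ b : ↥(beltPiece 3 1), (b.1.1 : EuclideanSpace ℝ (Fin 4)) = crossVec u s ∧
      A (circlePt (t₀ + s)) = E.jB 0 b) ∧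
    (∀ (θ : Metric.sphere (0 : EuclideanSpace ℝ (Fin 2)) 1) (b : ↥(beltPiece 3 1)),
      lamSq 1 (b.1.1 : EuclideanSpace ℝ (Fin 4)) = 0 → A θ = E.jB 0 b → θ = circlePt t₀) ∧
    (∀ (θ : Metric.sphere (0 : EuclideanSpace ℝ (Fin 2)) 1) (b : ↥(beltPiece 3 1)),
      lamSq 1 (b.1.1 : EuclideanSpace ℝ (Fin 4)) = 0 → A θ ≠ E.jB 1 b)
  /-- `qA` attaches along `A` with page twisting `−1` (a positive letter) -/
  qA_circle : qA.attachingCircle = A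
  qA_twist : pageTwisting (g + 1) A qA.attachingFraming = -1
  /-- `qA` IS THE STANDARD TUBE MAP (`TubeAttachData.attachingMap`, `HandleAttachingMapOfTube.lean`)
  of a FIBRED tube `Φ` around `A` (core `A`; first fibre coordinate inside the page, second = page
  angle, scale `σ`), with Kosinski's fibre coordinate twisted once around the core (sign `s`, the one
  giving page twisting `−1`): its values on the boundary torus `T ∩ ∂D⁴` are explicit — the input of
  the dual computation N3d-5 -/
  qA_tube : ∃ (Φ : Metric.sphere (0 : EuclideanSpace ℝ (Fin 2)) 1 × EuclideanSpace ℝ (Fin 2) → Base (g + 1))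
      (κ σ : ℝ) (s : Bool), 0 < κ ∧ σ ≠ 0 ∧
    ContMDiff ((𝓡 1).prod (𝓡 2)) (𝓡∂ 4) ∞ Φ ∧ InjOn Φ (univ ×ˢ Metric.ball 0 (2 * κ)) ∧
    (∀ x, Φ (x, 0) = A x) ∧
    (∀ x v, ‖v‖ < 2 * κ → Φ (x, v) ∈ page (g + 1) (pageDir (n + 4) 0 * Complex.exp ((σ * v 1 : ℝ) * Complex.I))) ∧
    (∀ (x : Metric.sphere (0 : EuclideanSpace ℝ (Fin 2)) 1) (v : EuclideanSpace ℝ (Fin 2)) (_ : ‖v‖ < 1)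
      (y : ↥(handleTube 3 2)),
      (y.1.1 : EuclideanSpace ℝ (Fin 4)) =
        WithLp.toLp 2 ![Real.sqrt (1 - ‖v‖ ^ 2) * x.1 0, Real.sqrt (1 - ‖v‖ ^ 2) * x.1 1, v 0, v 1] →
      qA.toFun y = Φ (x, κ • WithLp.toLp 2 ![x.1 0 * v 0 + (if s then 1 else -1) * x.1 1 * v 1,
        x.1 0 * v 1 - (if s then 1 else -1) * x.1 1 * v 0]))
  /-- the same for `B`: page `pageDir (n+4) 2`, class `b`, crossing the belt sphere of `1` once, missing `0` -/
  B_emb : Manifold.IsSmoothEmbedding (𝓡 1) (𝓡∂ 4) ∞ B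
  B_page : ∀ θ, B θ ∈ page (g + 1) (pageDir (n + 4) 2)
  B_shadow : shadow (g + 1) B B_emb.isEmbedding.continuous = newF g
  B_cross : ∃ (t₀ : ℝ) (u : EuclideanSpace ℝ (Fin 3)) (ε : ℝ), ‖u‖ = 1 ∧ 0 < ε ∧
    (∀ s ∈ Ioo (-ε) ε, ∃ b : ↥(beltPiece 3 1), (b.1.1 : EuclideanSpace ℝ (Fin 4)) = crossVec u s ∧
      B (circlePt (t₀ + s)) = E.jB 1 b) ∧
    (∀ (θ : Metric.sphere (0 : EuclideanSpace ℝ (Fin 2)) 1) (b : ↥(beltPiece 3 1)),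
      lamSq 1 (b.1.1 : EuclideanSpace ℝ (Fin 4)) = 0 → B θ = E.jB 1 b → θ = circlePt t₀) ∧
    (∀ (θ : Metric.sphere (0 : EuclideanSpace ℝ (Fin 2)) 1) (b : ↥(beltPiece 3 1)),
      lamSq 1 (b.1.1 : EuclideanSpace ℝ (Fin 4)) = 0 → B θ ≠ E.jB 0 b)
  qB_circle : qB.attachingCircle = B
  qB_twist : pageTwisting (g + 1) B qB.attachingFraming = -1
  /-- `qB` is the standard tube map of a fibred tube around `B` (as `qA_tube`, direction `pageDir (n+4) 2`) -/
  qB_tube : ∃ (Φ : Metric.sphere (0 : EuclideanSpace ℝ (Fin 2)) 1 × EuclideanSpace ℝ (Fin 2) → Base (g + 1))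
      (κ σ : ℝ) (s : Bool), 0 < κ ∧ σ ≠ 0 ∧
    ContMDiff ((𝓡 1).prod (𝓡 2)) (𝓡∂ 4) ∞ Φ ∧ InjOn Φ (univ ×ˢ Metric.ball 0 (2 * κ)) ∧
    (∀ x, Φ (x, 0) = B x) ∧
    (∀ x v, ‖v‖ < 2 * κ → Φ (x, v) ∈ page (g + 1) (pageDir (n + 4) 2 * Complex.exp ((σ * v 1 : ℝ) * Complex.I))) ∧
    (∀ (x : Metric.sphere (0 : EuclideanSpace ℝ (Fin 2)) 1) (v : EuclideanSpace ℝ (Fin 2)) (_ : ‖v‖ < 1)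
      (y : ↥(handleTube 3 2)),
      (y.1.1 : EuclideanSpace ℝ (Fin 4)) =
        WithLp.toLp 2 ![Real.sqrt (1 - ‖v‖ ^ 2) * x.1 0, Real.sqrt (1 - ‖v‖ ^ 2) * x.1 1, v 0, v 1] →
      qB.toFun y = Φ (x, κ • WithLp.toLp 2 ![x.1 0 * v 0 + (if s then 1 else -1) * x.1 1 * v 1,
        x.1 0 * v 1 - (if s then 1 else -1) * x.1 1 * v 0]))
  /-- the two block maps have disjoint ranges, inside the block part of the model region of the new base -/
  qAB_disjoint : Disjoint (range qA.toFun) (range qB.toFun)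
  range_qA : ∀ y, qA.toFun y ∈ modelRegion (g + 1) n δ₀ ε₁ ∧ w (g + 1) (qA.toFun y).1 ∈ blockSector n
  range_qB : ∀ y, qB.toFun y ∈ modelRegion (g + 1) n δ₀ ε₁ ∧ w (g + 1) (qB.toFun y).1 ∈ blockSector n

/-- **N3d-0 interface: a NORMALISED, RE-SPACED fibred datum of `M` adapted to the base data `S`**:
a fibred datum `(X, h, D, bX, Ψ)` of `(g, l)` glued into `M`, whose old handles sit in the pages of
directions `pageDir (n+4) (k+4)` (the positions they will have in the stabilised word) with the old
shadows and twistings and ranges OFF the block sector and INSIDE `‖x‖² < 4 − ε₁` (hence off every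
model region; shrink by locality, push the rims of the pages inward by a fibred squeeze), page-preserving
`Ψ`, and whose SEAM MAP `e = Ψ ∘ bX.incl⁻¹ ∘ D.jA` is the IDENTITY on the thickened binding tube
`‖x‖² > 4 − ε₁` of `∂Base g` (a solid torus around the binding containing the feet of the 1-handles
of `S`). [cite: EtnyreFuller2006, §2] -/
def NormalisedDatum (M : Type) [TopologicalSpace M] [ChartedSpace (EuclideanSpace ℝ (Fin 4)) M]
    (g : ℕ) (l : IntWord g) {c : Fin g ⊕ Fin g → ℤ} (S : StabBaseData g l.length c) : Prop :=
  ∃ (X : Type) (_ : TopologicalSpace X) (_ : T2Space X) (_ : SecondCountableTopology X)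
    (_ : CompactSpace X) (_ : ChartedSpace (EuclideanHalfSpace 4) X) (_ : IsManifold (𝓡∂ 4) ∞ X)
    (h : Fin l.length → HandleAttachingMap 3 2 (Base g)) (D : MultiAttachmentData h (𝓡∂ 4) X)
    (bX : BoundaryData (𝓡∂ 4) X (𝓡 3)) (Ψ : bX.carrier ≃ₘ⟮𝓡 3, 𝓡 3⟯ (bBase g).carrier),
    (∀ (i : Fin l.length) θ, (h i).attachingCircle θ ∈ page g (pageDir (l.length + 4) (i + 4))) ∧
    (∀ i, shadow g (h i).attachingCircle (h i).continuous_attachingCircle = (l.get i).1) ∧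
    (∀ i, pageTwisting g (h i).attachingCircle (h i).attachingFraming = if (l.get i).2 then -1 else 1) ∧
    (∀ i y, w g ((h i).toFun y).1 ∉ blockSector l.length ∧ ‖cx ((h i).toFun y).1‖ ^ 2 < 4 - S.ε₁) ∧
    IsBoundaryGluing bX (bBase g) Ψ (𝓡 4) M ∧
    (∀ (y : bX.carrier) (a : ↥(coresComplement h)), bX.incl y = D.jA a →
      ∃ r : ℝ, 0 < r ∧ w g ((bBase g).incl (Ψ y)).1 = (r : ℂ) * w g (a : Base g).1) ∧
    (∀ (y : bX.carrier) (a : ↥(coresComplement h)),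
      bX.incl y = D.jA a → 4 - S.ε₁ < ‖cx (a : Base g).1‖ ^ 2 → (bBase g).incl (Ψ y) = (a : Base g))

/-- **N3d-3 interface: THE TWO-SIDED STABILISED FIBRED MODEL of `M` over `Base (g+1)`** adapted to
`S` — the output of the rebase and the input of the trading: `M = X₁ ∪_ι W₂` (`IsBoundaryGluing`) with
`X₁` the multi-attachment over `Base (g+1)` of the family `Sum.elim ![S.qA, S.qB] hold` (the two
positive block handles at positions `0`, `2` and the old handles re-planted at positions `k + 4` with
shadows `embed` of the old classes, old twistings, ranges off the block sector), `W₂` the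
multi-attachment over `Base (g+1)` of two further maps `q'` (the cap-side cancelling 2-handles, traded
away later: no conditions), `ι` (i) direction-preserving from the `X₁`-seam to the `W₂`-seam, (ii) with
the seam/belt dichotomy backwards (a `W₂`-seam point comes from an `X₁`-seam point of the same direction
or from a deep belt point of an OLD handle, over that handle's direction), and (iii) THE MATCHING
CLAUSE: near the belts of the two block handles `ι` is the identity in Kosinski's model coordinates
(`D₁.jB (inl i) b ↦ D₂.jB i b`), so that trading `W₂`'s handles into `X₁` attaches the duals along
`X₁`'s own belt tubes of `qA`, `qB`. [cite: EtnyreFuller2006, §2] -/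
def TwoSidedStabModel (M : Type) [TopologicalSpace M] [ChartedSpace (EuclideanSpace ℝ (Fin 4)) M]
    (g : ℕ) (l : IntWord g) {c : Fin g ⊕ Fin g → ℤ} (S : StabBaseData g l.length c) : Prop :=
  ∃ (X₁ : Type) (_ : TopologicalSpace X₁) (_ : T2Space X₁) (_ : SecondCountableTopology X₁)
    (_ : CompactSpace X₁) (_ : ChartedSpace (EuclideanHalfSpace 4) X₁) (_ : IsManifold (𝓡∂ 4) ∞ X₁)
    (W₂ : Type) (_ : TopologicalSpace W₂) (_ : T2Space W₂) (_ : SecondCountableTopology W₂)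
    (_ : CompactSpace W₂) (_ : ChartedSpace (EuclideanHalfSpace 4) W₂) (_ : IsManifold (𝓡∂ 4) ∞ W₂)
    (hold : Fin l.length → HandleAttachingMap 3 2 (Base (g + 1)))
    (D₁ : MultiAttachmentData (Sum.elim ![S.qA, S.qB] hold) (𝓡∂ 4) X₁)
    (q' : Fin 2 → HandleAttachingMap 3 2 (Base (g + 1))) (D₂ : MultiAttachmentData q' (𝓡∂ 4) W₂)
    (b₁ : BoundaryData (𝓡∂ 4) X₁ (𝓡 3)) (b₂ : BoundaryData (𝓡∂ 4) W₂ (𝓡 3))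
    (ι : b₁.carrier ≃ₘ⟮𝓡 3, 𝓡 3⟯ b₂.carrier),
    (∀ (k : Fin l.length) θ, (hold k).attachingCircle θ ∈ page (g + 1) (pageDir (l.length + 4) (k + 4))) ∧
    (∀ k, shadow (g + 1) (hold k).attachingCircle (hold k).continuous_attachingCircle =
      embed g (l.get k).1) ∧
    (∀ k, pageTwisting (g + 1) (hold k).attachingCircle (hold k).attachingFraming =
      if (l.get k).2 then -1 else 1) ∧
    (∀ k y, w (g + 1) ((hold k).toFun y).1 ∉ blockSector l.length) ∧
    IsBoundaryGluing b₁ b₂ ι (𝓡 4) M ∧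
    (∀ (y : b₁.carrier) (a : ↥(coresComplement (Sum.elim ![S.qA, S.qB] hold))), b₁.incl y = D₁.jA a →
      ∃ (a' : ↥(coresComplement q')) (r : ℝ), 0 < r ∧ b₂.incl (ι y) = D₂.jA a' ∧
        w (g + 1) (a' : Base (g + 1)).1 = (r : ℂ) * w (g + 1) (a : Base (g + 1)).1) ∧
    (∀ (y : b₁.carrier) (a' : ↥(coresComplement q')), b₂.incl (ι y) = D₂.jA a' →
      (∃ (a : ↥(coresComplement (Sum.elim ![S.qA, S.qB] hold))) (r : ℝ), 0 < r ∧
          b₁.incl y = D₁.jA a ∧ w (g + 1) (a : Base (g + 1)).1 = (r : ℂ) * w (g + 1) (a' : Base (g + 1)).1) ∨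
      (∃ (k : Fin l.length) (b : ↥(beltPiece 3 2)) (r : ℝ), 0 < r ∧ b₁.incl y = D₁.jB (Sum.inr k) b ∧
          b₁.incl y ∉ range D₁.jA ∧ w (g + 1) (a' : Base (g + 1)).1 = (r : ℂ) * pageDir (l.length + 4) (k + 4))) ∧
    (∃ κ : ℝ, 0 < κ ∧ ∀ (i : Fin 2) (b : ↥(beltPiece 3 2)) (y : b₁.carrier),
      lamSq 2 (b.1.1 : EuclideanSpace ℝ (Fin 4)) < κ → b₁.incl y = D₁.jB (Sum.inl i) b →
        b₂.incl (ι y) = D₂.jB i b)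

/-! ## §3 THE PIECES of N3-nat (sub-nodes; `sorry` = the debt) -/

/-- **N3d-1 (`node_stabBaseData`) — the stabilised base data exist** for every genus `g`, word length
`n` and primitive-or-zero arc class `c`.  Content and plan: see `StabBaseData`.  G1a: a smooth family of
page embeddings `F_g(w) ↪ F_{g+1}(w)`, `|w| ≤ 1/2` (double covers of the `x`-disc branched at the roots
of `x^{2g+1} = −1−w` resp. `x^{2g+3} = −1−w`: slit the new configuration's two extra roots off by an
explicit smooth isotopy of branch configurations lifted to the covers — Milnor 1968 §9; G7-REPORT §0
route (A)); G1b: thicken to the 4-dimensional `E` (Kosinski multi-attachment data of two index-1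
handles on `Base (g+1)`: `E.jA` = the page family on the pages, radial in `rho`, identity in depth off
the model region; `E.jB` the two model 1-handles over the cut arcs); G1c: `shadow ∘ E.jA = embed ∘
shadow` from the chain loops (`E.jA ∘ chainLoop g i ≃ chainLoop (g+1) i`, `i < 2g`, then G7's landed
`shadow_comp_eq_embed`); G1d: twisting transport (fibred ⇒ the page frame `(iK', n)` is carried to a
frame homotopic to the page frame, cf. `pageTwisting_transport_eq_of_fibred` p132432); G1e: block
curves `A = core_a ∪ (rim arc # E ∘ γ_c)` with `γ_c` an embedded curve of class `c` in the OLD flat page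
of direction `pageDir (n+4) 0` (N3a `node_STcurve`, G6; `c = 0`: no `γ`), `B = core_b ∪ rim arc`,
classes by `shadow_embed` + additivity (`HurewiczOne`), and the maps `qA qB` by N3c (TUBE
`exists_handleAttachingMap_of_isKnotFraming_holds` with a framing of prescribed page twisting `−1`,
`Gompf1998_addLeftTwists`-type adjustment).  Size XXL (2500–4500 lines). [cite: Milnor1968, §9] -/
theorem node_stabBaseData :
    ∀ (g n : ℕ) (c : Fin g ⊕ Fin g → ℤ), (c = 0 ∨ IsPrimitive c) → Nonempty (StabBaseData g n c) := by
  sorry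

/-- **N3d-0 (`node_normalisedDatum`) — gauge normalisation and re-spacing.**  From `ModelsOnFibred M g l`
(data `(X, h, D, bX, Ψ)`): (1) RE-SPACE: G4's sector-supported fibred rotations `helper_rotFlow_sector`
(one handle at a time, through free sectors) give an ambient isotopy `R` of `Base g` with `R₁` carrying
`page g (pageDir n k)` onto `page g (pageDir (n+4) (k+4))`, identity near the binding; transport `D`
along `R₁` (`IsMultiAttachment.transport`), replace `Ψ` by `∂R₁ ∘ Ψ` (`IsBoundaryGluing` transported by
the cap diffeomorphism `R₁`, `M` unchanged); shadows by `shadow_comp_ambientIsotopy` p131188, twistings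
by `pageTwisting_transport_eq_of_fibred` p132432; shrink the old maps off the model region
(`HandleAttachingMap.shrink`, locality).  (2) GAUGE: the seam map `e` is a page-preserving open
embedding `∂Base g ∖ cores → ∂Base g` fixing the binding setwise; if it reverses the orientation of the
binding circle (equivalently of the pages; decided by X4's orientation character at one seam point),
replace `Ψ` by `∂σ ∘ Ψ` with V3's fibred involution `σ = baseReflection g` (`w ∘ σ = w`, transfer by
`σ`); then on the binding tube (`tube g` coordinates `(P, v)`, `w ∝ v`) `e` has the form
`(P, v) ↦ (P'(P, v), μ(P, v) · v)` with `μ > 0` and `P ↦ P'(P, 0)` orientation preserving, which is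
fibred-isotopic to the inclusion (`s ↦ (P + s(P' − P), (1 + s(μ − 1)) v)`); cut off, this is a fibred
isotopy of `∂Base g` supported in `‖x‖² > 4 − 2ε₁`, diffeotopic to the identity, after which `e = id` on
`‖x‖² > 4 − ε₁`; extend it over a collar of the cap
(`BoundaryData.exists_diffeomorph_comp_incl_eq_of_isDiffeotopicToId`) and transfer.  (3) RIMS: before
(2), push the old attaching circles into `‖x‖² < 4 − 2ε₁` by a fibred squeeze of the page rims
(`x ↦ λ(‖x‖²) x`, `y` re-solved; pages are unbranched over `‖x‖ > 3/2`), transporting `D` only (the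
gluing of `M` is untouched by a re-parametrisation of the base).  Size M–L (700–1100 lines).
[cite: EtnyreFuller2006, §2] -/
theorem node_normalisedDatum :
    ∀ (M : Type) [TopologicalSpace M] [T2Space M] [SecondCountableTopology M]
      [ChartedSpace (EuclideanSpace ℝ (Fin 4)) M] [IsManifold (𝓡 4) ∞ M] (g : ℕ) (l : IntWord g)
      (c : Fin g ⊕ Fin g → ℤ) (S : StabBaseData g l.length c),
      ModelsOnFibred M g l → NormalisedDatum M g l S := by
  sorry

/-- **N3d-2 (`node_cancel`) — cancellation of the two (1,2)-pairs: the doubly stabilised base is the old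
base, by a diffeomorphism which is the identity off the model region.**  For every model `V` of
`Base (g+1) ∪ qA ∪ qB` (multi-attachment data `DV`): a diffeomorphism `Λ : V ≅ Base g` with
`Λ (DV.jA (S.E.jA a)) = a` for every point `a` of the old base off the model region (in particular near
every old handle and on the old seam there).  General lemma behind it (to be proved once, any index):
Kosinski 1993 VI (7.4) / Milnor 1965 Thm. 5.4 — `M ∪ H^λ ∪ H^{λ+1}` with the attaching sphere of
`H^{λ+1}` meeting the belt sphere of `H^λ` transversally in one point is diffeomorphic to `M` by a
diffeomorphism equal to the identity off any prescribed neighbourhood of `(feet of H^λ) ∪ (attaching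
region of H^{λ+1}) ∩ M`; here `λ = 1`, `m = 4`, twice (the pairs are disjoint: `A` misses the belt
sphere of `1`, `B` that of `0`), the model position of the crossing being clause `A_cross`/`B_cross`.
Route: straighten `qA` near the crossing to the product model (locality `of_eqOn_near_sphere` +
uniqueness of tubular neighbourhoods), then the explicit model `D⁴ = D⁴ ∪ h¹ ∪ h²` transported
(`hasHandleDecomposition_closedBall_four_oneOneOne` is the Morse shadow of the same fact).  Size XL
(1200–2000 lines). [cite: Kosinski1993, VI (7.4)] -/
theorem node_cancel :
    ∀ (g n : ℕ) (c : Fin g ⊕ Fin g → ℤ) (S : StabBaseData g n c)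
      (V : Type) [TopologicalSpace V] [T2Space V] [SecondCountableTopology V] [CompactSpace V]
      [ChartedSpace (EuclideanHalfSpace 4) V] [IsManifold (𝓡∂ 4) ∞ V]
      (DV : MultiAttachmentData ![S.qA, S.qB] (𝓡∂ 4) V),
      ∃ Λ : V ≃ₘ⟮𝓡∂ 4, 𝓡∂ 4⟯ Base g,
        ∀ (a : ↥(coresComplement S.q1)) (ha : S.E.jA a ∈ coresComplement ![S.qA, S.qB]),
          (a : Base g) ∉ modelRegion g n S.δ₀ S.ε₁ → Λ (DV.jA ⟨S.E.jA a, ha⟩) = (a : Base g) := by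
  sorry

/-- **N3d-3 (`node_rebase`) — the two-sided stabilised model from a normalised datum and the
cancellation.**  Given `NormalisedDatum M g l S` (data `(X, h, D, bX, Ψ)`, seam map `e`, `= id` near the
feet) and the cancellations `Λ` of N3d-2: HANDLEBODY SIDE: `X₁ :=` the multi-attachment over
`Base (g+1)` of `Sum.elim ![S.qA, S.qB] hold`, `hold k := S.E.jA ∘ h k` (lifts: old ranges miss the
model region), exists (`exists_isMultiAttachment_holds`); by associativity of multi-attachments (same
index: `isMultiAttachment_cons`/`isAttachment_lift_of_isMultiAttachment_cons`; and the mixed-index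
regrouping "1-handles first") `X₁ ≅ V ∪ old⁗` with `V = Base (g+1) ∪ qA ∪ qB`, and `Λ ∪ id : V ∪ old⁗ ≅
Base g ∪ old = X₀ ≅ X` (uniqueness, canonical on pieces): `G_X : X₁ ≅ X` with
`G_X ∘ D₁.jA ∘ E.jA = D.jA` off the model region.  CAP SIDE: `ê := e × id` on the fibred collar of depth
`δ₀` over (binding region ∪ block sector) — defined because that part of `∂Base g` misses the old cores;
`W₂ := V^e :=` the multi-attachment over `Base (g+1)` (SAME base: `e = id` on the 1-handle ranges, so the
`ê`-transported 1-handle maps ARE `S.q1`) of the two `ê`-transported block maps `q' i`; `Λ^e := ê ∘ Λ ∘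
ê_V⁻¹` on the model part, `E⁻¹` elsewhere (well defined: `Λ = E⁻¹` near the frontier of the model
region), a diffeomorphism `W₂ ≅ Base g`.  GLUING: `M = X ∪_Ψ Base g = X₁ ∪_{ι} W₂`,
`ι := ∂(Λ^e)⁻¹ ∘ Ψ ∘ ∂G_X`, by two `IsBoundaryGluing.transfer`s; on the block handles `ι = Λ⁻¹ ê⁻¹ e Λ =
id` in model coordinates (matching clause); on the other seam points `ι = E ∘ e ∘ E⁻¹` in base
coordinates, direction-preserving (`e` page-preserving, `E` fibred); the backward dichotomy by the LANDED
belt clause `helper_belt_pageClause` for the original datum.  The link clauses of `hold` from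
`NormalisedDatum` + `S.flat/shadow_embed/twisting_transport`.  Size L–XL (900–1600 lines).
[cite: EtnyreFuller2006, §2] -/
theorem node_rebase :
    ∀ (M : Type) [TopologicalSpace M] [T2Space M] [SecondCountableTopology M]
      [ChartedSpace (EuclideanSpace ℝ (Fin 4)) M] [IsManifold (𝓡 4) ∞ M] (g : ℕ) (l : IntWord g)
      (c : Fin g ⊕ Fin g → ℤ) (S : StabBaseData g l.length c),
      NormalisedDatum M g l S →
      (∀ (V : Type) [TopologicalSpace V] [T2Space V] [SecondCountableTopology V] [CompactSpace V]
        [ChartedSpace (EuclideanHalfSpace 4) V] [IsManifold (𝓡∂ 4) ∞ V]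
        (DV : MultiAttachmentData ![S.qA, S.qB] (𝓡∂ 4) V),
        ∃ Λ : V ≃ₘ⟮𝓡∂ 4, 𝓡∂ 4⟯ Base g,
          ∀ (a : ↥(coresComplement S.q1)) (ha : S.E.jA a ∈ coresComplement ![S.qA, S.qB]),
            (a : Base g) ∉ modelRegion g l.length S.δ₀ S.ε₁ → Λ (DV.jA ⟨S.E.jA a, ha⟩) = (a : Base g)) →
      TwoSidedStabModel M g l S := by
  sorry

/-- **N3d-4/5/6 (`node_trade`) — trading the cap-side handles, identifying the duals, finishing.**
From `TwoSidedStabModel M g l S` (`M = X₁ ∪_ι W₂`):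
N3d-4 TRADE (T3's landed general trading with the roles of the two pieces swapped: V5
`exists_compatible_split`/`exists_standardForm`, Y6 `exists_complementPiece`, X1
`exists_dualAttachmentData` — trade BOTH handles of the multi-attachment `W₂` (family `q'`, prefix `∅`)
into the other piece `X₁`): `M = Base (g+1) ∪_φ (X₁ ∪ q₀^∨ ∪ q₁^∨)`, the dual maps being collar-pushes
through `ι⁻¹` of the belt tubes of `q' i` = (matching clause) collar-pushes of `X₁`'s OWN belt tubes of
`qA`, `qB`, and `φ⁻¹` = `D₂.jA⁻¹ ∘ ι` on the `X₁`-seam off the duals (direction-preserving by clause (i)).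
N3d-5 DUAL-std: the collar-push of the belt tube of the STANDARD handle `qA` (explicit TUBE model, page
twisting `−1`) along the fibred collar of `Base (g+1)` inside `X₁` (`D₁.jA`-image; collars matched by
`BoundaryCollarMatching`) is, after pushing off the belt page into the page `pageDir (n+4) 0 · e^{−iη}`
(ISO), fibred-isotopic to a Lefschetz map along a curve of shadow `± (newE g + embed g c)` with page
twisting `+1` (the explicit version of X3's `seam_twistSign`/Y3's transport: the pushed belt circle is
the `(1, ∓1)`-cable of the `δ`-tube of `A`, cf. `AchiralLefschetzModel.attachModel`; sign of the shadow
fixed by re-framing `HandleAttachingMap.reframe` with `diag(−1,1,1,1)` if needed); same for `qB`.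
N3d-6 FINISH: G4's sector rotation inside the free sector carries the two duals to the pages
`pageDir (n+4) 1`, `pageDir (n+4) 3` (old ranges are off the block sector; `qA`, `qB` fixed: rotations
supported in `(pos 0, pos 2)` resp. `(pos 2, pos 4)`), `isMultiAttachment_cons` twice + reindexing
`Fin 2 ⊕ Fin 2 ⊕ Fin n ≃ Fin (n+4)` give `IsLefschetzLink (g+1) (natWord g c l) h''` and multi-attachment
data on (a manifold diffeomorphic to) `X₁ ∪ duals`; the page clause of the final `Ψ''` from clause (i),
(ii) and the fibredness of the rotations; `modelsOnFibred_of_transfer` (p128002).  Size XL–XXL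
(1900–3500 lines: 400–800 + 1000–1800 + 500–900). [cite: Baykur2006, §5 p. 13] -/
theorem node_trade :
    ∀ (M : Type) [TopologicalSpace M] [T2Space M] [SecondCountableTopology M]
      [ChartedSpace (EuclideanSpace ℝ (Fin 4)) M] [IsManifold (𝓡 4) ∞ M] (g : ℕ) (l : IntWord g)
      (c : Fin g ⊕ Fin g → ℤ) (S : StabBaseData g l.length c),
      TwoSidedStabModel M g l S → ModelsOnFibred M (g + 1) (natWord g c l) := by
  sorry

/-! ## §4 N3-nat PROVED from the pieces (literal composition) -/

/-- **`node_STnat` from N3d-1, N3d-0, N3d-2, N3d-3, N3d-4/5/6** (the pieces enter as their closed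
∀-statements, verbatim). [cite: EtnyreFuller2006, §2] -/
theorem node_STnat_of_pieces
    (h1 : ∀ (g n : ℕ) (c : Fin g ⊕ Fin g → ℤ), (c = 0 ∨ IsPrimitive c) → Nonempty (StabBaseData g n c))
    (h0 : ∀ (M : Type) [TopologicalSpace M] [T2Space M] [SecondCountableTopology M]
      [ChartedSpace (EuclideanSpace ℝ (Fin 4)) M] [IsManifold (𝓡 4) ∞ M] (g : ℕ) (l : IntWord g)
      (c : Fin g ⊕ Fin g → ℤ) (S : StabBaseData g l.length c),
      ModelsOnFibred M g l → NormalisedDatum M g l S)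
    (h2 : ∀ (g n : ℕ) (c : Fin g ⊕ Fin g → ℤ) (S : StabBaseData g n c)
      (V : Type) [TopologicalSpace V] [T2Space V] [SecondCountableTopology V] [CompactSpace V]
      [ChartedSpace (EuclideanHalfSpace 4) V] [IsManifold (𝓡∂ 4) ∞ V]
      (DV : MultiAttachmentData ![S.qA, S.qB] (𝓡∂ 4) V),
      ∃ Λ : V ≃ₘ⟮𝓡∂ 4, 𝓡∂ 4⟯ Base g,
        ∀ (a : ↥(coresComplement S.q1)) (ha : S.E.jA a ∈ coresComplement ![S.qA, S.qB]),
          (a : Base g) ∉ modelRegion g n S.δ₀ S.ε₁ → Λ (DV.jA ⟨S.E.jA a, ha⟩) = (a : Base g))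
    (h3 : ∀ (M : Type) [TopologicalSpace M] [T2Space M] [SecondCountableTopology M]
      [ChartedSpace (EuclideanSpace ℝ (Fin 4)) M] [IsManifold (𝓡 4) ∞ M] (g : ℕ) (l : IntWord g)
      (c : Fin g ⊕ Fin g → ℤ) (S : StabBaseData g l.length c),
      NormalisedDatum M g l S →
      (∀ (V : Type) [TopologicalSpace V] [T2Space V] [SecondCountableTopology V] [CompactSpace V]
        [ChartedSpace (EuclideanHalfSpace 4) V] [IsManifold (𝓡∂ 4) ∞ V]
        (DV : MultiAttachmentData ![S.qA, S.qB] (𝓡∂ 4) V),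
        ∃ Λ : V ≃ₘ⟮𝓡∂ 4, 𝓡∂ 4⟯ Base g,
          ∀ (a : ↥(coresComplement S.q1)) (ha : S.E.jA a ∈ coresComplement ![S.qA, S.qB]),
            (a : Base g) ∉ modelRegion g l.length S.δ₀ S.ε₁ → Λ (DV.jA ⟨S.E.jA a, ha⟩) = (a : Base g)) →
      TwoSidedStabModel M g l S)
    (h4 : ∀ (M : Type) [TopologicalSpace M] [T2Space M] [SecondCountableTopology M]
      [ChartedSpace (EuclideanSpace ℝ (Fin 4)) M] [IsManifold (𝓡 4) ∞ M] (g : ℕ) (l : IntWord g)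
      (c : Fin g ⊕ Fin g → ℤ) (S : StabBaseData g l.length c),
      TwoSidedStabModel M g l S → ModelsOnFibred M (g + 1) (natWord g c l)) :
    ∀ (M : Type) [TopologicalSpace M] [T2Space M] [SecondCountableTopology M]
      [ChartedSpace (EuclideanSpace ℝ (Fin 4)) M] [IsManifold (𝓡 4) ∞ M] (g : ℕ) (l : IntWord g)
      (c : Fin g ⊕ Fin g → ℤ), (c = 0 ∨ IsPrimitive c) →
      ModelsOnFibred M g l → ModelsOnFibred M (g + 1) (natWord g c l) := by
  intro M _ _ _ _ _ g l c hc hM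
  obtain ⟨S⟩ := h1 g l.length c hc
  exact h4 M g l c S (h3 M g l c S (h0 M g l c S hM) (fun V _ _ _ _ _ _ DV => h2 g l.length c S V DV))

/-- **N3-nat (`node_STnat`, model level) — the natural front stabilisation pair.**  A fibred model
`ModelsOnFibred M g l` and a primitive-or-zero arc class `c` give a fibred model of THE SAME `M` over
`Base (g+1)` with word `natWord g c l = (a,+)(a,−)(b,+)(b,−) ++ embed l`.  Geometric content
(Etnyre–Fuller 2006 §2 p. 5, Baykur 2006 Lemma 1, two-sided): gauge-normalise the datum near four
binding points and re-space the old handles (N3d-0); present `Base (g+1) = Base g ∪ 2 h¹` fibred-ly and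
build the block curves and maps (N3d-1); cancel `(h¹_a, qA)`, `(h¹_b, qB)` on the handlebody side and
their `ê`-transported copies on the cap side with ONE cancellation diffeomorphism `Λ` (N3d-2, N3d-3):
`M = X₁ ∪_ι W₂` with `X₁ = Base (g+1) ∪ qA ∪ qB ∪ old⁗`, `W₂ = Base (g+1) ∪ 2` positive handles, `ι`
the identity in model coordinates on the block handles; trade `W₂`'s handles into `X₁` (T3's landed
machinery), identify the duals as `(a;+1)`, `(b;+1)` pushed into the adjacent pages, rotate them to
positions `1`, `3` (N3d-4/5/6).  PROVED from the pieces (`node_STnat_of_pieces`): its `sorry`s are exactly N3d-0 … N3d-6.  Size: the sum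
of §2 of the module docstring. [cite: EtnyreFuller2006, §2] -/
theorem node_STnat :
    ∀ (M : Type) [TopologicalSpace M] [T2Space M] [SecondCountableTopology M]
      [ChartedSpace (EuclideanSpace ℝ (Fin 4)) M] [IsManifold (𝓡 4) ∞ M] (g : ℕ) (l : IntWord g)
      (c : Fin g ⊕ Fin g → ℤ), (c = 0 ∨ IsPrimitive c) →
      ModelsOnFibred M g l → ModelsOnFibred M (g + 1) (natWord g c l) :=
  node_STnat_of_pieces node_stabBaseData node_normalisedDatum node_cancel node_rebase node_trade

/-! ## §5 TOP: the registered text of `stub_STgeo`, PROVED from the sub-nodes -/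

/-- **N3 as registered (`stub_STgeo`, text `work/stubs/sig_stub_STgeo.txt` VERBATIM), from the
sub-nodes**: N3-nat (`node_STnat`, itself `node_STnat_of_pieces` of N3d-0…6) and N1 (`node_M2geo`),
through the LANDED algebra (`hurwitzSteps_natBlock_stabBlock_front`, p165085), (HS) reduction (p134969)
and belt clause (N2, `helper_belt_pageClause`), gluing existence/uniqueness.  Baykur 2006 Lemma 1 and
§5 p. 13; Etnyre–Fuller 2006 §2; Gompf–Stipsicz 1999 §8.2. [cite: Baykur2006, Lemma 1] -/
theorem node_STgeo_proved : ∀ (g : ℕ) (l : Literature.GroupTheory.CombinatorialGroupTheory.SignedHurwitz.IntWord g) (c : Fin g ⊕ Fin g → ℤ), (c = 0 ∨ Literature.GroupTheory.CombinatorialGroupTheory.SignedHurwitz.IsPrimitive c) → ∀ (X : Type) [TopologicalSpace X] [T2Space X] [SecondCountableTopology X] [CompactSpace X] [ChartedSpace (EuclideanHalfSpace 4) X] [IsManifold (𝓡∂ 4) ∞ X] (h : Fin l.length → Literature.Topology.FourManifolds.HandleAttachingMap 3 2 (Literature.Topology.FourManifolds.LefschetzBase.Base g)) (D : Literature.Topology.FourManifolds.HandleAttachingMap.MultiAttachmentData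 h (𝓡∂ 4) X) (bX : Literature.Topology.FourManifolds.BoundaryData (𝓡∂ 4) X (𝓡 3)) (Ψ : bX.carrier ≃ₘ⟮𝓡 3, 𝓡 3⟯ (Literature.Topology.FourManifolds.LefschetzBase.bBase g).carrier), Literature.Topology.FourManifolds.LefschetzBase.IsLefschetzLink g l h → (∀ (y : bX.carrier) (a : ↥(Literature.Topology.FourManifolds.HandleAttachingMap.coresComplement h)), bX.incl y = D.jA a → ∃ c : ℝ, 0 < c ∧ Literature.Topology.FourManifolds.LefschetzBase.w g ((Literature.Topology.FourManifolds.LefschetzBase.bBase g).incl (Ψ y)).1 = (c : ℂ) * Literature.Topology.FourManifolds.LefschetzBase.w g (a : Literature.Topology.FourManifolds.LefschetzBase.Base g).1) → ∃ (X' : Type) (_ : TopologicalSpace X') (_ : T2Space X') (_ : SecondCountableTopology X') (_ : CompactSpace X') (_ : ChartedSpace (EuclideanHalfSpace 4) X') (_ : IsManifold (𝓡∂ 4) ∞ X') (h' : Fin (Literature.GroupTheory.CombinatorialGroupTheory.SignedHurwitz.stabBlock g c ++ Literature.GroupTheory.CombinatorialGroupTheory.SignedHurwitz.mapWord (Literature.GroupTheory.CombinatorialGroupTheory.SignedHurwitz.embed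 g) l).length → Literature.Topology.FourManifolds.HandleAttachingMap 3 2 (Literature.Topology.FourManifolds.LefschetzBase.Base (g + 1))) (D' : Literature.Topology.FourManifolds.HandleAttachingMap.MultiAttachmentData h' (𝓡∂ 4) X') (bX' : Literature.Topology.FourManifolds.BoundaryData (𝓡∂ 4) X' (𝓡 3)) (Ψ' : bX'.carrier ≃ₘ⟮𝓡 3, 𝓡 3⟯ (Literature.Topology.FourManifolds.LefschetzBase.bBase (g + 1)).carrier), Literature.Topology.FourManifolds.LefschetzBase.IsLefschetzLink (g + 1) (Literature.GroupTheory.CombinatorialGroupTheory.SignedHurwitz.stabBlock g c ++ Literature.GroupTheory.CombinatorialGroupTheory.SignedHurwitz.mapWord (Literature.GroupTheory.CombinatorialGroupTheory.SignedHurwitz.embed g) l) h' ∧ (∀ (y : bX'.carrier) (a : ↥(Literature.Topology.FourManifolds.HandleAttachingMap.coresComplement h')), bX'.incl y = D'.jA a → ∃ c' : ℝ, 0 < c' ∧ Literature.Topology.FourManifolds.LefschetzBase.w (g + 1) ((Literature.Topology.FourManifolds.LefschetzBase.bBase (g + 1)).incl (Ψ' y)).1 = (c' : ℂ) * Literature.Topology.FourManifolds.LefschetzBase.w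 (g + 1) (a : Literature.Topology.FourManifolds.LefschetzBase.Base (g + 1)).1) ∧ ∀ (M M' : Type) [TopologicalSpace M] [ChartedSpace (EuclideanSpace ℝ (Fin 4)) M] [IsManifold (𝓡 4) ∞ M] [TopologicalSpace M'] [ChartedSpace (EuclideanSpace ℝ (Fin 4)) M'] [IsManifold (𝓡 4) ∞ M'], Literature.Topology.FourManifolds.IsBoundaryGluing bX (Literature.Topology.FourManifolds.LefschetzBase.bBase g) Ψ (𝓡 4) M → Literature.Topology.FourManifolds.IsBoundaryGluing bX' (Literature.Topology.FourManifolds.LefschetzBase.bBase (g + 1)) Ψ' (𝓡 4) M' → Nonempty (M ≃ₘ⟮𝓡 4, 𝓡 4⟯ M') :=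
  stgeo_of_st_front (st_front_of_nodes node_STnat (hs_of_nodes node_M2geo))

end N3Design

end Summit.SmoothPoincare4.SmoothPoincare4.Theorems.AcyclicBisectionExists.ModpBraidOrbits

end
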